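import Summits.KontsevichZagierPeriods.KontsevichZagierPeriods.Theses.GenericPointClass

/-!
# `DivergenceKernelConjecture` (stmt-KontsevichZagierPeriods-4428, route GenericPointClass, rank 5) — birth skeleton

Crux (OPEN CORE of the route, summit-strength modulo `ExactDescentBox`): the period conjecture for the
Kontsevich–Zagier calculus ENLARGED by the box-divergence rule — every subgroup `R ≥ KZ.relations` that
contains `[r] − Σᵢ [sᵢ]` for every exact box datum (`r` an open box in `ℝⁿ⁺¹` whose integrand is an
explicit divergence `Σᵢ ∂ᵢAᵢ` with `ℚ`-semialgebraic potentials `Aᵢ` continuous on the closed box, `sᵢ`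
the `n + 1` face representations `Aᵢ(xᵢ = bᵢ) − Aᵢ(xᵢ = aᵢ)`) contains `ker KZ.eval`.

Line `birth` = the route's own mechanism for its core, VARIABLE ELIMINATION ("integrate out the top
variable: descend by the divergence rule where the generic-point class vanishes, go up first where it
does not"), cut as a STRENGTHEN-TO-INDUCT skeleton on the dimension filtration
`F_N = ⟨[r] : dim r ≤ N⟩ ≤ KZ.FormalRep`:

* `stub_topDimElimination` (the OPEN CORE in induction-ready, `R`-free form; summit-flavoured, implied
  by `KZKernelConjecture` with `E = c' = 0`): a null combination of top dimension `≤ N + 1` is, modulo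
  the FOUR moves, an element of the span of exact box divergences `[r] − Σᵢ [sᵢ]` plus a combination of
  top dimension `≤ N`. This is where the invariant `c(r) ∈ Hⁿ_dR(ℚ(x)(g)/ℚ)` of the route acts: the
  `c = 0` layer IS an exact divergence up to null modifications (Theorem A/B of the route), the `c ≠ 0`
  layer must first be lifted (Kontsevich–Zagier's "sideways" moves, e.g. ζ(2)'s square) — the stub
  asserts that lifting + exact descent always clears the top layer of a NULL combination.
  Why it might fail: only with the summit (it is implied by `KZKernelConjecture`); the informative
  failure mode is a null combination whose top layer is provably not exact modulo lifts of bounded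
  height — the route's HeightZeroCriterion territory (card N4).
* `stub_exactBoxDivergenceSound` (analysis, provable now, size M/L): the VALUE SHADOW of the rule —
  `KZ.eval ([r] − Σᵢ [sᵢ]) = 0` for every exact box datum, i.e. the Gauss–Ostrogradsky formula on a
  box for a field with `Aᵢ` continuous on the closed box and `∂ᵢAᵢ` existing and integrable on the
  open box: per `i`, Fubini along coordinate `i` (`MeasureTheory.volume_preserving_piFinSuccAbove`) and
  the fibrewise FTC `intervalIntegral.integral_eq_sub_of_hasDerivAt_of_le`, exactly as in the tree proof
  `KZ.eval_eq_zero_of_mem_newtonLeibnizRel_holds`; cf. Mathlib's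
  `MeasureTheory.integral_divergence_of_hasFDerivWithinAt_off_countable` (stronger hypotheses).
* `stub_dimZeroKernel` (algebra of the calculus in dimension `0`, provable now, size M): a null
  combination of CONSTANTS (representations in dimension `0`: domain `∅` or the point `Fin 0 → ℝ` of
  volume `1`) is a relation — integrand additivity (1b) merges point representations, domain
  additivity (1a) kills empty ones, and a point representation of value `0` has integrand `0 = 0 + 0`.
  No transcendence enters (the values are real algebraic, but this is not even used).

Composition (sorry-free, below): `DivergenceKernelConjecture_of : ⟨stub₁⟩ → ⟨stub₂⟩ → ⟨stub₃⟩ →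
DivergenceKernelConjecture` — every formal combination has a level (`FreeAbelianGroup.induction_on`);
induction on the level `N`: at `N = 0` the base stub and `KZ.relations ≤ R`; at `N + 1` the elimination
stub gives `c ≡ E + c'` modulo `KZ.relations ≤ R` with `E` in the exact-divergence span (`≤ R` because
`R` is closed under the rule, and `≤ ker KZ.eval` by the soundness stub) and `c'` of level `N`, null by
`KZ.relations_le_ker_eval_holds`, so the induction hypothesis applies. The three stubs are fed in BY
NAME in the closing leaf `divergenceKernelConjecture_of_stubs`. Disproof used: none on file (the crux directory had no `Disproof.lean`,
no ideas, no dead lines at registration; `ledger negatives --problem KontsevichZagierPeriods` consulted).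

BC3 (registrar's probes, `bc/DivergenceKernelConjecture_probes.lean`): for each stub,
`stub → DivergenceKernelConjecture` and `stub → KontsevichZagierPeriods` by
`first | exact? | simpa | aesop` FAIL (no stub is cheaply the crux or the summit).
-/

set_option linter.dupNamespace false

noncomputable section

namespace Summit.KontsevichZagierPeriods.KontsevichZagierPeriods.Cruxes.DivergenceKernelConjecture.Birth

open scoped BigOperators
open Summit.KontsevichZagierPeriods.KontsevichZagierPeriods.Theses.GenericPointClass (DivergenceKernelConjecture)

/-! ## The three stubs -/

/-- Stub 1 — TOP-DIMENSION ELIMINATION FOR NULL COMBINATIONS (the open core, induction-ready and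
`R`-free). If `c` is a formal combination of representations of dimension `≤ N + 1` with
`KZ.eval c = 0`, then modulo the FOUR moves `c` is an element `E` of the span of exact box divergences
`[r] − Σᵢ [sᵢ]` (any dimension; data exactly as in the crux / `ExactDescentBox`) plus a combination
`c'` of representations of dimension `≤ N`: `c − E − c' ∈ KZ.relations`. Implied by
`KZKernelConjecture` (`E = c' = 0`); with Stubs 2–3 it implies the crux (composition below). The
route's invariant decides the two regimes of the step: `c(r) = 0` ⇒ `r` is an exact divergence up to
null modifications and descends; `c(r) ≠ 0` (ζ(2)'s square, `HyperbolaFormNotExact`) ⇒ lift first.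
Sources: KontsevichZagier2001 §1.2; HuberMullerStach2017 Ch. 13; Ayoub2015; CressonViusos2022 §2.
Size: open-problem (summit-flavoured). -/
theorem stub_topDimElimination : ∀ (N : ℕ) (c : Literature.NumberTheory.Transcendental.KZ.FormalRep), c ∈ AddSubgroup.closure {x : Literature.NumberTheory.Transcendental.KZ.FormalRep | ∃ (n : ℕ) (r : Literature.NumberTheory.Transcendental.KZ.IntegralRep n), n ≤ N + 1 ∧ x = Literature.NumberTheory.Transcendental.KZ.of r} → Literature.NumberTheory.Transcendental.KZ.eval c = 0 → ∃ (E c' : Literature.NumberTheory.Transcendental.KZ.FormalRep), E ∈ AddSubgroup.closure {x : Literature.NumberTheory.Transcendental.KZ.FormalRep | ∃ (n : ℕ) (a b : Fin (n + 1) → ℝ) (r : Literature.NumberTheory.Transcendental.KZ.IntegralRep (n + 1)) (A A' : Fin (n + 1) → (Fin (n + 1) → ℝ) → ℝ) (s : Fin (n + 1) → Literature.NumberTheory.Transcendental.KZ.IntegralRep n), (∀ i, a i < b i) ∧ r.domain = {z | ∀ i, z i ∈ Set.Ioo (a i) (b i)} ∧ (∀ i, Literature.NumberTheory.Transcendental.IsSemialgebraicFunOn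 ℚ {z | ∀ j, z j ∈ Set.Icc (a j) (b j)} (A i)) ∧ (∀ i, ContinuousOn (A i) {z | ∀ j, z j ∈ Set.Icc (a j) (b j)}) ∧ (∀ i, ∀ z ∈ r.domain, HasDerivAt (fun t : ℝ => A i (Function.update z i t)) (A' i z) (z i)) ∧ (∀ i, Literature.NumberTheory.Transcendental.IsSemialgebraicFunOn ℚ r.domain (A' i)) ∧ (∀ i, MeasureTheory.IntegrableOn (A' i) r.domain) ∧ Set.EqOn r.integrand (fun z => ∑ i, A' i z) r.domain ∧ (∀ i, (s i).domain = {y | ∀ j, y j ∈ Set.Ioo (a (Fin.succAbove i j)) (b (Fin.succAbove i j))}) ∧ (∀ i, Set.EqOn (s i).integrand (fun y => A i (Fin.insertNth i (b i) y) - A i (Fin.insertNth i (a i) y)) (s i).domain) ∧ x = Literature.NumberTheory.Transcendental.KZ.of r - ∑ i, Literature.NumberTheory.Transcendental.KZ.of (s i)} ∧ c' ∈ AddSubgroup.closure {x : Literature.NumberTheory.Transcendental.KZ.FormalRep | ∃ (n : ℕ) (r : Literature.NumberTheory.Transcendental.KZ.IntegralRep n), n ≤ N ∧ x = Literature.NumberTheory.Transcendental.KZ.of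 r} ∧ c - E - c' ∈ Literature.NumberTheory.Transcendental.KZ.relations := by
  sorry

/-- Stub 2 — SOUNDNESS OF THE BOX-DIVERGENCE RULE (its value shadow; analysis, provable now). For an
open box `∏ (aᵢ, bᵢ) ⊂ ℝⁿ⁺¹`, potentials `Aᵢ` continuous on the closed box with `∂ᵢAᵢ = A'ᵢ` on the
open box, `A'ᵢ` integrable there, `r.integrand = Σᵢ A'ᵢ` on the open box and face representations
`sᵢ = [∏_{j ≠ i} (aⱼ, bⱼ), Aᵢ(xᵢ = bᵢ) − Aᵢ(xᵢ = aᵢ)]`, the combination `[r] − Σᵢ [sᵢ]` evaluates to `0`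
(Gauss–Ostrogradsky on a box: linearity, then per `i` Fubini along coordinate `i` and the fibrewise
FTC `intervalIntegral.integral_eq_sub_of_hasDerivAt_of_le`, as in
`KZ.eval_eq_zero_of_mem_newtonLeibnizRel_holds`). The semialgebraicity hypotheses are the rule's data
and are not used by the value identity. Sources: KontsevichZagier2001 §1.2 rule 3 ("Stokes's
formula"); Mathlib `MeasureTheory.integral_divergence_of_hasFDerivWithinAt_off_countable`. Size M/L. -/
theorem stub_exactBoxDivergenceSound : ∀ (n : ℕ) (a b : Fin (n + 1) → ℝ) (r : Literature.NumberTheory.Transcendental.KZ.IntegralRep (n + 1)) (A A' : Fin (n + 1) → (Fin (n + 1) → ℝ) → ℝ) (s : Fin (n + 1) → Literature.NumberTheory.Transcendental.KZ.IntegralRep n), (∀ i, a i < b i) → r.domain = {z | ∀ i, z i ∈ Set.Ioo (a i) (b i)} → (∀ i, Literature.NumberTheory.Transcendental.IsSemialgebraicFunOn ℚ {z | ∀ j, z j ∈ Set.Icc (a j) (b j)} (A i)) → (∀ i, ContinuousOn (A i) {z | ∀ j, z j ∈ Set.Icc (a j) (b j)}) → (∀ i, ∀ z ∈ r.domain, HasDerivAt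 (fun t : ℝ => A i (Function.update z i t)) (A' i z) (z i)) → (∀ i, Literature.NumberTheory.Transcendental.IsSemialgebraicFunOn ℚ r.domain (A' i)) → (∀ i, MeasureTheory.IntegrableOn (A' i) r.domain) → Set.EqOn r.integrand (fun z => ∑ i, A' i z) r.domain → (∀ i, (s i).domain = {y | ∀ j, y j ∈ Set.Ioo (a (Fin.succAbove i j)) (b (Fin.succAbove i j))}) → (∀ i, Set.EqOn (s i).integrand (fun y => A i (Fin.insertNth i (b i) y) - A i (Fin.insertNth i (a i) y)) (s i).domain) → Literature.NumberTheory.Transcendental.KZ.eval (Literature.NumberTheory.Transcendental.KZ.of r - ∑ i, Literature.NumberTheory.Transcendental.KZ.of (s i)) = 0 := by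
  sorry

/-- Stub 3 — NULL COMBINATIONS OF CONSTANTS ARE RELATIONS (base of the induction; algebra of the
calculus in dimension `0`, provable now). A formal combination of dimension-`0` representations
(domain `∅` or the one-point space `Fin 0 → ℝ`, of volume `1`; value `= integrand default` or `0`)
with `KZ.eval c = 0` lies in `KZ.relations`: integrand additivity (1b) merges two point
representations into one (`IsSemialgebraicFunOn.add`), domain additivity (1a) with `∅ = ∅ ∪ ∅` kills
empty-domain representations, so `c ≡ [r]` for a single point representation with
`r.integrand default = KZ.eval c = 0`, and `[r] − [r] − [r] ∈ integrandAddRel` (`0 = 0 + 0`).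
Sources: KontsevichZagier2001 §1.2 rule 1; tree `Literature.NumberTheory.Transcendental.KZCalculus`.
Size M. -/
theorem stub_dimZeroKernel : ∀ (c : Literature.NumberTheory.Transcendental.KZ.FormalRep), c ∈ AddSubgroup.closure {x : Literature.NumberTheory.Transcendental.KZ.FormalRep | ∃ (r : Literature.NumberTheory.Transcendental.KZ.IntegralRep 0), x = Literature.NumberTheory.Transcendental.KZ.of r} → Literature.NumberTheory.Transcendental.KZ.eval c = 0 → c ∈ Literature.NumberTheory.Transcendental.KZ.relations := by
  sorry

/-! ## Composition (sorry-free) -/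

open Literature.NumberTheory.Transcendental

/-- Every formal combination has a level: it lies in `F_N = ⟨[r] : dim r ≤ N⟩` for some `N`
(induction on the free abelian group). [cite: KontsevichZagier2001, §1.2] -/
theorem exists_level (c : KZ.FormalRep) :
    ∃ N : ℕ, c ∈ AddSubgroup.closure {x : KZ.FormalRep | ∃ (n : ℕ) (r : KZ.IntegralRep n), n ≤ N ∧ x = KZ.of r} := by
  have hmono : ∀ {N M : ℕ}, N ≤ M →
      AddSubgroup.closure {x : KZ.FormalRep | ∃ (n : ℕ) (r : KZ.IntegralRep n), n ≤ N ∧ x = KZ.of r} ≤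
        AddSubgroup.closure {x : KZ.FormalRep | ∃ (n : ℕ) (r : KZ.IntegralRep n), n ≤ M ∧ x = KZ.of r} := by
    intro N M hNM
    refine AddSubgroup.closure_mono ?_
    rintro x ⟨n, r, hn, rfl⟩
    exact ⟨n, r, hn.trans hNM, rfl⟩
  induction c using FreeAbelianGroup.induction_on with
  | zero => exact ⟨0, AddSubgroup.zero_mem _⟩
  | of x =>
    obtain ⟨n, r⟩ := x
    exact ⟨n, AddSubgroup.subset_closure ⟨n, r, le_rfl, rfl⟩⟩
  | neg x hx =>
    obtain ⟨N, hN⟩ := hx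
    exact ⟨N, AddSubgroup.neg_mem _ hN⟩
  | add x y hx hy =>
    obtain ⟨N, hN⟩ := hx
    obtain ⟨M, hM⟩ := hy
    exact ⟨max N M, AddSubgroup.add_mem _ (hmono (le_max_left N M) hN) (hmono (le_max_right N M) hM)⟩

/-- **The skeleton theorem.** TOP-DIMENSION ELIMINATION → SOUNDNESS OF THE RULE → DIMENSION-ZERO BASE
→ `DivergenceKernelConjecture` (concluded BY NAME). Induction on the level of a null combination.
[cite: KontsevichZagier2001, §1.2 Conjecture 1] -/
theorem DivergenceKernelConjecture_of :
    (∀ (N : ℕ) (c : Literature.NumberTheory.Transcendental.KZ.FormalRep), c ∈ AddSubgroup.closure {x : Literature.NumberTheory.Transcendental.KZ.FormalRep | ∃ (n : ℕ) (r : Literature.NumberTheory.Transcendental.KZ.IntegralRep n), n ≤ N + 1 ∧ x = Literature.NumberTheory.Transcendental.KZ.of r} → Literature.NumberTheory.Transcendental.KZ.eval c = 0 → ∃ (E c' : Literature.NumberTheory.Transcendental.KZ.FormalRep), E ∈ AddSubgroup.closure {x : Literature.NumberTheory.Transcendental.KZ.FormalRep | ∃ (n : ℕ) (a b : Fin (n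 + 1) → ℝ) (r : Literature.NumberTheory.Transcendental.KZ.IntegralRep (n + 1)) (A A' : Fin (n + 1) → (Fin (n + 1) → ℝ) → ℝ) (s : Fin (n + 1) → Literature.NumberTheory.Transcendental.KZ.IntegralRep n), (∀ i, a i < b i) ∧ r.domain = {z | ∀ i, z i ∈ Set.Ioo (a i) (b i)} ∧ (∀ i, Literature.NumberTheory.Transcendental.IsSemialgebraicFunOn ℚ {z | ∀ j, z j ∈ Set.Icc (a j) (b j)} (A i)) ∧ (∀ i, ContinuousOn (A i) {z | ∀ j, z j ∈ Set.Icc (a j) (b j)}) ∧ (∀ i, ∀ z ∈ r.domain, HasDerivAt (fun t : ℝ => A i (Function.update z i t)) (A' i z) (z i)) ∧ (∀ i, Literature.NumberTheory.Transcendental.IsSemialgebraicFunOn ℚ r.domain (A' i)) ∧ (∀ i, MeasureTheory.IntegrableOn (A' i) r.domain) ∧ Set.EqOn r.integrand (fun z => ∑ i, A' i z) r.domain ∧ (∀ i, (s i).domain = {y | ∀ j, y j ∈ Set.Ioo (a (Fin.succAbove i j)) (b (Fin.succAbove i j))}) ∧ (∀ i, Set.EqOn (s i).integrand (fun y => A i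 (Fin.insertNth i (b i) y) - A i (Fin.insertNth i (a i) y)) (s i).domain) ∧ x = Literature.NumberTheory.Transcendental.KZ.of r - ∑ i, Literature.NumberTheory.Transcendental.KZ.of (s i)} ∧ c' ∈ AddSubgroup.closure {x : Literature.NumberTheory.Transcendental.KZ.FormalRep | ∃ (n : ℕ) (r : Literature.NumberTheory.Transcendental.KZ.IntegralRep n), n ≤ N ∧ x = Literature.NumberTheory.Transcendental.KZ.of r} ∧ c - E - c' ∈ Literature.NumberTheory.Transcendental.KZ.relations) →
    (∀ (n : ℕ) (a b : Fin (n + 1) → ℝ) (r : Literature.NumberTheory.Transcendental.KZ.IntegralRep (n + 1)) (A A' : Fin (n + 1) → (Fin (n + 1) → ℝ) → ℝ) (s : Fin (n + 1) → Literature.NumberTheory.Transcendental.KZ.IntegralRep n), (∀ i, a i < b i) → r.domain = {z | ∀ i, z i ∈ Set.Ioo (a i) (b i)} → (∀ i, Literature.NumberTheory.Transcendental.IsSemialgebraicFunOn ℚ {z | ∀ j, z j ∈ Set.Icc (a j) (b j)} (A i)) → (∀ i, ContinuousOn (A i) {z | ∀ j, z j ∈ Set.Icc (a j) (b j)}) →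 (∀ i, ∀ z ∈ r.domain, HasDerivAt (fun t : ℝ => A i (Function.update z i t)) (A' i z) (z i)) → (∀ i, Literature.NumberTheory.Transcendental.IsSemialgebraicFunOn ℚ r.domain (A' i)) → (∀ i, MeasureTheory.IntegrableOn (A' i) r.domain) → Set.EqOn r.integrand (fun z => ∑ i, A' i z) r.domain → (∀ i, (s i).domain = {y | ∀ j, y j ∈ Set.Ioo (a (Fin.succAbove i j)) (b (Fin.succAbove i j))}) → (∀ i, Set.EqOn (s i).integrand (fun y => A i (Fin.insertNth i (b i) y) - A i (Fin.insertNth i (a i) y)) (s i).domain) → Literature.NumberTheory.Transcendental.KZ.eval (Literature.NumberTheory.Transcendental.KZ.of r - ∑ i, Literature.NumberTheory.Transcendental.KZ.of (s i)) = 0) →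
    (∀ (c : Literature.NumberTheory.Transcendental.KZ.FormalRep), c ∈ AddSubgroup.closure {x : Literature.NumberTheory.Transcendental.KZ.FormalRep | ∃ (r : Literature.NumberTheory.Transcendental.KZ.IntegralRep 0), x = Literature.NumberTheory.Transcendental.KZ.of r} → Literature.NumberTheory.Transcendental.KZ.eval c = 0 → c ∈ Literature.NumberTheory.Transcendental.KZ.relations) →
    DivergenceKernelConjecture := by
  intro h_elim h_sound h_base R hR hdiv c hc
  -- the span of exact box divergences lies in `R` (closure of `R` under the rule) ...
  have hER : AddSubgroup.closure {x : KZ.FormalRep | ∃ (n : ℕ) (a b : Fin (n + 1) → ℝ) (r : KZ.IntegralRep (n + 1)) (A A' : Fin (n + 1) → (Fin (n + 1) → ℝ) → ℝ) (s : Fin (n + 1) → KZ.IntegralRep n), (∀ i, a i < b i) ∧ r.domain = {z | ∀ i, z i ∈ Set.Ioo (a i) (b i)} ∧ (∀ i, IsSemialgebraicFunOn ℚ {z | ∀ j, z j ∈ Set.Icc (a j) (b j)} (A i)) ∧ (∀ i, ContinuousOn (A i) {z | ∀ j, z j ∈ Set.Icc (a j) (b j)}) ∧ (∀ i, ∀ z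 ∈ r.domain, HasDerivAt (fun t : ℝ => A i (Function.update z i t)) (A' i z) (z i)) ∧ (∀ i, IsSemialgebraicFunOn ℚ r.domain (A' i)) ∧ (∀ i, MeasureTheory.IntegrableOn (A' i) r.domain) ∧ Set.EqOn r.integrand (fun z => ∑ i, A' i z) r.domain ∧ (∀ i, (s i).domain = {y | ∀ j, y j ∈ Set.Ioo (a (Fin.succAbove i j)) (b (Fin.succAbove i j))}) ∧ (∀ i, Set.EqOn (s i).integrand (fun y => A i (Fin.insertNth i (b i) y) - A i (Fin.insertNth i (a i) y)) (s i).domain) ∧ x = KZ.of r - ∑ i, KZ.of (s i)} ≤ R := by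
    refine (AddSubgroup.closure_le _).2 ?_
    rintro x ⟨n, a, b, r, A, A', s, hab, hdom, hA, hAc, hderiv, hA', hint, hsum, hsdom, hsint, rfl⟩
    exact hdiv n a b r A A' s hab hdom hA hAc hderiv hA' hint hsum hsdom hsint
  -- ... and in the kernel of `KZ.eval` (soundness of the rule)
  have hEker : AddSubgroup.closure {x : KZ.FormalRep | ∃ (n : ℕ) (a b : Fin (n + 1) → ℝ) (r : KZ.IntegralRep (n + 1)) (A A' : Fin (n + 1) → (Fin (n + 1) → ℝ) → ℝ) (s : Fin (n + 1) → KZ.IntegralRep n), (∀ i, a i < b i) ∧ r.domain = {z | ∀ i, z i ∈ Set.Ioo (a i) (b i)} ∧ (∀ i, IsSemialgebraicFunOn ℚ {z | ∀ j, z j ∈ Set.Icc (a j) (b j)} (A i)) ∧ (∀ i, ContinuousOn (A i) {z | ∀ j, z j ∈ Set.Icc (a j) (b j)}) ∧ (∀ i, ∀ z ∈ r.domain, HasDerivAt (fun t : ℝ => A i (Function.update z i t)) (A' i z) (z i)) ∧ (∀ i, IsSemialgebraicFunOn ℚ r.domain (A' i)) ∧ (∀ i, MeasureTheory.IntegrableOn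 (A' i) r.domain) ∧ Set.EqOn r.integrand (fun z => ∑ i, A' i z) r.domain ∧ (∀ i, (s i).domain = {y | ∀ j, y j ∈ Set.Ioo (a (Fin.succAbove i j)) (b (Fin.succAbove i j))}) ∧ (∀ i, Set.EqOn (s i).integrand (fun y => A i (Fin.insertNth i (b i) y) - A i (Fin.insertNth i (a i) y)) (s i).domain) ∧ x = KZ.of r - ∑ i, KZ.of (s i)} ≤ KZ.eval.ker := by
    refine (AddSubgroup.closure_le _).2 ?_
    rintro x ⟨n, a, b, r, A, A', s, hab, hdom, hA, hAc, hderiv, hA', hint, hsum, hsdom, hsint, rfl⟩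
    exact AddMonoidHom.mem_ker.2 (h_sound n a b r A A' s hab hdom hA hAc hderiv hA' hint hsum hsdom hsint)
  -- soundness of the four moves (tree theorem)
  have hrelker : ∀ {x : KZ.FormalRep}, x ∈ KZ.relations → KZ.eval x = 0 := fun hx =>
    AddMonoidHom.mem_ker.1 (KZ.relations_le_ker_eval_holds hx)
  -- induction on the level of the null combination
  suffices H : ∀ (N : ℕ) (c : KZ.FormalRep),
      c ∈ AddSubgroup.closure {x : KZ.FormalRep | ∃ (n : ℕ) (r : KZ.IntegralRep n), n ≤ N ∧ x = KZ.of r} →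
        KZ.eval c = 0 → c ∈ R by
    obtain ⟨N, hN⟩ := exists_level c
    exact H N c hN hc
  intro N
  induction N with
  | zero =>
    intro c hcF hc0
    refine hR (h_base c ?_ hc0)
    refine (AddSubgroup.closure_mono ?_) hcF
    rintro x ⟨n, r, hn, rfl⟩
    obtain rfl : n = 0 := Nat.le_zero.mp hn
    exact ⟨r, rfl⟩
  | succ N ih =>
    intro c hcF hc0
    obtain ⟨E, c', hE, hc', hrel⟩ := h_elim N c hcF hc0
    have hE0 : KZ.eval E = 0 := AddMonoidHom.mem_ker.1 (hEker hE)
    have hc'0 : KZ.eval c' = 0 := by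
      have h1 : KZ.eval (c - E - c') = 0 := hrelker hrel
      simp only [map_sub] at h1
      linarith
    have hsplit : c = (c - E - c') + E + c' := by abel
    rw [hsplit]
    exact R.add_mem (R.add_mem (hR hrel) (hER hE)) (ih c' hc' hc'0)

/-- The leaf from the registered stubs: the three stubs compose ON THE NOSE to the crux
(`DivergenceKernelConjecture_of` fed with `stub_topDimElimination`, `stub_exactBoxDivergenceSound`,
`stub_dimZeroKernel` by name; sorries enter only through the stubs). -/
theorem divergenceKernelConjecture_of_stubs : DivergenceKernelConjecture :=
  DivergenceKernelConjecture_of stub_topDimElimination stub_exactBoxDivergenceSound stub_dimZeroKernel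

end Summit.KontsevichZagierPeriods.KontsevichZagierPeriods.Cruxes.DivergenceKernelConjecture.Birth

end
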